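import Summits.ResolutionOfSingularities.ResolutionOfSingularities.Theorems.NearCutCompanion3
import Summits.ResolutionOfSingularities.ResolutionOfSingularities.Theorems.NearCutWalls2
import Summits.ResolutionOfSingularities.ResolutionOfSingularities.Theorems.ProximityCutArcLaw
import Summits.ResolutionOfSingularities.ResolutionOfSingularities.Theorems.MaxContactCutBoundaryLedger
import Summits.ResolutionOfSingularities.ResolutionOfSingularities.Theorems.MaxContactCutWallCut
import Summits.ResolutionOfSingularities.ResolutionOfSingularities.Theorems.PlanarGhostDescent
import Literature.AlgebraicGeometry.Resolution.PointBlowupIFPGiraud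
import Literature.AlgebraicGeometry.Resolution.AdicNoetherian
import HarnessLib

/-!
# WallFrames (1/17) — Kollár's wall descent in a polynomial frame; sections: —

Verbatim slice of the farm-checked monolith `WallFrames.lean` of cell `decomp-res`, seat `decomp-res-lens-5`, g35
(sha256 7405a21d81d102a4…, monolith lines 165–333); one namespace `Summit.ResolutionOfSingularities.ResolutionOfSingularities.Theorems.WallFrames` across the
slices, imports chained.  The monolith's module docstring (laws W1–W7, mechanism, novelty, honest placement) is
reproduced in slice 1; the main theorem `balancedWallPort_holds : WallCut.BalancedWallPort` (hypothesis-free) and the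
host-route corollary `ecBalancedWallPort_holds` (aside item 27368 of route MaxContactCut) are in slice 16/17.
-/

/-!
# WallFrames — Kollár's wall descent in a polynomial frame: `WallCut.BalancedWallPort` HOLDS
# (programme «WallDescent», generations 1/2 AND 2/2 delivered in this node; cell `decomp-res`, seat `decomp-res-lens-5`, g35;
# critic pricing row 219a (P1): the +1 is `balancedWallPort_holds`, priced ONCE)

MAIN THEOREM (§23): `balancedWallPort_holds : WallCut.BalancedWallPort` (`WallCutClasses` :120; registered aside item 27368
`MaxContactCut.ECBalancedWallPort` BY NAME = `ecBalancedWallPort_holds`), HYPOTHESIS-FREE, every prime `p`, every exponent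
`e`, standard axioms.  It is reached through `False`: a δ-BALANCED TAME TAIL WITH RECURRING PROXIMITY REPEATS DOES NOT
EXIST (the conclusion `∃ N₁ w S, …` of the port is then trivial).  CONSEQUENCES (§24, by the LANDED wirings
`WallCut.noTameBalancedStrictTails_of_port`, `WallCut.noBalancedBoundaryTails_of_balancedWallPort`,
`WallCut.kollarWallPort_of_balancedWallPort`, `WallCut.defectWalksDeep_iff_of_port`, `ProximityCut.noFreePointTailsDeep_holds`,
`GhostDescent.noHighPlanarJointTailsDeep_holds`): `kollarWallPort_holds : ExtinctionCut.KollarWallPort`,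
`noTameBalancedStrictTailsDeep_holds`, `noBalancedBoundaryTailsDeep_holds`, and the EXACT HYPOTHESIS-FREE RESIDUAL of the
host aside 31770: `defectWalksDeep_iff_lossy_wild : MaxContactCut.DefectWalksDeep ↔ NoLossyStrictTailsDeep ∧
NoWildBalancedStrictTailsDeep`.

MECHANISM.  No power series, no Weierstrass preparation, no implicit function theorem: Kollár's coefficient transport
[Kollar2007 Thm 1.93, Claim 2.59.1–4; Literature `KollarResolutionBook` §2.7] is run INSIDE `MvPolynomial` along lens-3's
companion chain `G_{n+1} = translate b_n (chartTransform s j_n G_n)` (`NearCut.companion`, structure invariant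
`NearCut.TailInv` / `tailInv_of_balanced`, no hypothesis on `e`) in a POLYNOMIAL FRAME: a shear `y_f ↦ y_f + ζ` by a jet
`ζ` (factor theorem) of ONE transported Hasse lineage `h_n` (Giraud), units carried in LABELLED UNIT-WEIGHTED PRESENTATIONS
whose index sets move EXACTLY by the toric word of the walk (`ExtinctionCut.step`), far parts controlled by a threshold
budget that drops by `s` per move.  The landed toric kernel `ExtinctionCut.extinction` (lens-3 g20) then puts every near
index into the quadrant at the horizon `max t_U t_V + s + 1`, which contradicts `ForcedWalk.isolated` through the
Hasse-derivative ideal law of §10.  Law map (critic (w2): W1–W7), §§1–14 the frame laws, §§15–24 the walk: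

* §1 `zshear` [new]: the shear `y_z ↦ y_z + ζ` (`ζ` `z`-free): composition, inverse, injectivity, `ordZero`-invariance,
  `z`-freeness calculus (incl. stability under `chartTransform 1 j`, `j ≠ z`); JET CONSISTENCY `zshear z ε Q − Q ∈ (ε)`
  (`zshear_sub_self_mem_span`) and UNSHEARING OF IDEAL POWERS (`mem_span_pow_of_zshear_mem`).
* §2 THE EXACT TRANSPORT LAW (W5, lost-wall chart `j ≠ z`, centre on the free axis) [new]:
  `zshear z (cT₁ʲζ − C b_z) (translate b (cT_sʲ G)) = cT_sʲ (zshear z ζ G)` — in the sheared frame a lost-wall move IS the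
  monomial map `chartExponent s j` (Kollár K1a/K1b); FAR PARTS (wall-degree `≥ Λ` off the free letter) stay far up to `s`
  (`far_chartTransform`) and form a monomial ideal (`mem_span_far_iff`: support form ↔ ideal form).
* §3 THE FREE-CHART SUBSTITUTION LAW (W7, chart `z` = the free index) [new]: the frame coordinate `y_z − ζ` has total
  transform `y_z · translate b (1 − cT₁ᶻ ζ)`.
* §4 IMPLICIT JETS BY THE FACTOR THEOREM (W4) [new]: `w = Q·(y_v − ζ) + w|_{y_v := ζ}`; for `w(0)=0`, `∂_v w(0) ≠ 0` and
  every depth `D` a `v`-free jet `ζ` with `ord w|_{y_v:=ζ} ≥ D+1` (`exists_jet`), unique to its depth (`jet_unique`),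
  cofactor a unit (`constantCoeff_factor`).
* §5 GIRAUD PERSISTENCE OF THE HASSE LINEAGE (W3, ANY charts) [new; consumes Literature `chartTransform_hasseDeriv_mem_span`
  = Giraud, KNOWN, by name]: `h_{n+1} = translate b_n (cT₁^{j_n} h_n)` stays in the span of the `D^{(M)}G_n`, `|M| ≤ s−1`, along
  any equimultiple chain; hence EVERY later centre lies on the lineage (`centre_on_lineage`), `y_i`-coefficients persist.
* §6 THE DIRECTRIX READING + RECENTRING (W1) [new]: `(translate b (cT_sʲG))(0) = in_s(G)(b[j ↦ 1])`; from the factor form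
  `h = Q(y_z − ζ) + r`, `ord r ≥ 2`, a centre on the lineage off the `z`-axis-complement has `b_z = coeff_{y_j} ζ` and the
  transported jet `cT₁ʲζ − C b_z` again has order `≥ 1` (`recentring`) — the torus-fixed centre law in frame currency.
* §7 STATIC LAWS (W5: K2, K3-ideal) [new]: every monomial of `zshear z ζ G` has degree `≥ ord G` (K2); if every monomial has
  `d_v + d_z ≥ s` then `G ∈ (y_v, y_z − ζ)^s` (K3, ideal form).
* §8 THE ROTATION LAW (W7) [new]: under a free-chart move the lineage factor form ROTATES:
  `translate b (cT₁ᶻ h) = translate b (cT₀ᶻ Q) · translate b (1 − cT₁ᶻ ζ) + y_z^{m−1} · translate b (cT_mᶻ r)` — new frame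
  germ `g″ = translate b (1 − cT₁ᶻζ)` with `g″`'s `y_v`-coefficient `= −coeff_{y_v} ζ` (`coeff_single_rotation_germ`), garbage
  wall-deep; the lost wall's letter becomes the new free letter, `E` takes the lost wall's slot.  Its lost-wall twin
  `frame_transport`: `translate b (cT₁ʲ h) = translate b (cT₀ʲ Q)·(y_z − ζ') + y_j^{m−1}·translate b (cT_mʲ r)`, `ζ' = cT₁ʲζ − b_z`.
* §9 THE TAME INITIAL FRAME (W2/W3 start) [new]: for `in_s G = c·ℓ^s`,
  `coeff_{y_f} D^{((s−1)e_f)} G = s·c·(coeff_{y_f} ℓ)^s` — non-zero iff `p ∤ s` (probe (w4): `(s : K) ≠ 0` is USED here), and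
  `D^{((s−1)e_f)}G (0) = 0`.
* §10 ISOLATION VS. FRAMES (K3 contradiction law; probe (w4): `ForcedWalk.isolated` is what it contradicts) [new]:
  `hasseDeriv_mem_pow_sub` (`D^{(d)}(I^n) ⊆ I^{n−|d|}`, every char.) and
  `not_isolatedTop_of_mem_framePow : F ∈ (y_v, y_z − ζ)^q → ¬ IsolatedTop q F`; `monomial_mul_mem_framePow` feeds it from
  `G ∈ (y_v, y_z − ζ)^s` and the δ-balance `q ≤ r_v + s` (probe (w4): balance USED here); WITH FAR REMAINDER AND
  `q`-POLYNOMIAL PART (the form g36 meets: `F = y^r U G + C_q`, `NearCut.TailInv`): `topIdeal_le_frame_sup_far`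
  (`topIdeal q (A + B + C) ≤ (y_v, y_z − ζ) ⊔ (y_u^Λ)` for `A ∈ frame^q`, `B ∈ (y_u,y_v)^{Λ+q}`, `C` Hasse-flat below `q`) and
  `not_mem_frame_sup_far` (`g·y_u^M ∉ (y_v, y_z − ζ) ⊔ (y_u^Λ)` for `g(0) ≠ 0`, `M < Λ`, via the substitution `exists_frameKill`).
* §11 UNIT-WEIGHTED PRESENTATIONS (W5 + W7 made EXACT AS SETS) [new]: `P = Σ_{n∈S} yⁿ·U_n + R`, `U_n(0) ≠ 0`:
  SANDWICH (`exists_le_of_mem_support_presentation`, `coeff_presentation_of_minimal` — minimal indices carry `U_n(0)`, so K2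
  from `ordZero` holds on all of `S`), LOST-WALL transport `cT_sʲ(yⁿU) = y^{χ(n)}·cT₀ʲU` (units stay units), FREE-CHART transport
  by the rotation substitution `rotSubst` (`freeChart_presentation`: index moves by Kollár's step EXACTLY, new cofactor
  `Ψ(U)(y_v+β+ζ″)^B Q̃^k` a UNIT (`constantCoeff_freeChart_unit`), remainder `∈ (r)` wall-deep (`sub_pow_mem_span`)).
  ⟹ `S_{t+1} = step_{w_t}(S_t)` literally, births absorbed into units: this is what replaces `K[[u,v]]`-Weierstrass.
  PACKAGED: `presentation_of_support` (initial split at threshold `Λ`), `presentation_transport` (lost-wall move: SAME index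
  set re-indexed by `χ`, units by `cT₀ʲ`, far part by `cT_sʲ`), `freeChart_conjugation` + `presentation_freeChart` (free-chart
  move: `y_z^s·σ″(translate b (cT_sᶻ G)) = rotSubst(σ_ζ G)`, explicit main terms / `(r_g)`-remainders / far images),
  `presentation_reshear` (jet re-extraction by a far `ε` moves only the far part), and K2 ON ALL INDICES incl. non-minimal
  ones: `degree_ge_of_mem_presentation` (`ord ≥ s` ⟹ every index of a unit-weighted presentation has degree `≥ s`).
* §12 FALSIFIER EXHIBIT (critic (w3), RUN): `freeChart_exhibit` — the δ-balanced tame state `G = y_u y_v (y_z + y_v)^3`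
  (shade 3, frame `Z = y_z + y_v`, near centre `(0:1:0)` NOT torus-fixed… i.e. off both wall axes of the free chart) blown up
  in the FREE chart `z` gives `y_u y_z (y_v+1)(y_v+2)^3` (char 2: `y_u y_z · y_v^3(y_v+1)`, again shade 3, tame): free-chart
  near moves OCCUR, the lost wall survives as the unit `y_v + 1`; hence (W7) is load-bearing and §3, §8, §11 carry it.
* §13 TRANSVERSALITY AND THE LINEAGE TANGENT LAW (W1/W2, for the g36 invariant `α_free ≠ 0`) [new]: axis propagation
  `translate b (cT_sʲ G) ≡ c·y_k^s (mod y_j)` when `in_s G = c·y_k^s` (`translate_chartTransform_sub_mem_span`), its degree-`s`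
  reading (`homogeneousComponent_eq_add_of_sub_mem_span`) and `transversal_of_congr` (`c'ℓ^s = c y_k^s + y_j L` ⟹ `ℓ ∈ ⟨y_j, y_k⟩`,
  `coeff_{y_k} ℓ ≠ 0`): an axis directrix is kept forever, contradicting `StaysOnNewest` recurrence; linear-form calculus
  (`eq_sum_of_isHomogeneous_one`, `eval_of_isHomogeneous_one` = the NEARNESS equation `ℓ_t(b̂) = 0`, `taylor_of_isHomogeneous_one`);
  APOLARITY `D^{(d)}(c·ℓ^s) = (s·c·coeff_d ℓ^{s−1})·ℓ` (`|d| = s−1`) and the LINEAGE TANGENT LAW `lineage_tangent`: every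
  `h ∈ hasseSpan (s−1) G` has `h(0) = 0` and linear part `μ·ℓ` — so the transported frame is transverse to the new free letter
  exactly when the directrix is (`coeff_single_one_mul` carries it through unit factors).
* §14 Hygiene rider (item 33395, weight 0, COSTUME by name): `MaxContactCut.BLNoLoadedCriticalPlateauxDeep` :=
  `ProximityCut.loaded_of_freeTails ProximityCut.noFreePointTailsDeep_holds`.

* §15 MOVE ANATOMY (walk ↔ frame dictionary) [new]: `move_anatomy` — on a δ-balanced move the centre chart is the lost
  wall or the free letter, the kept wall `k` has `b_k = 0`, and a free-chart move has `b_{lost} ≠ 0` (from `NearCut.st_succ_r`,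
  `NearCut.walls_succ`); `lost_of_staysOnNewest` — a proximity repeat loses the NEWEST wall.
* §16 TRANSVERSALITY ALONG THE TAIL (W1/W2 at walk level) [new]: `axis_of_coeff_eq_zero` + `nearness_sum` + `transversal`:
  the directrix `ℓ_n` of `G_n` has `coeff_{y_{f_n}} ℓ_n ≠ 0` for EVERY `n` — else an axis directrix propagates forever
  (§13) and forbids the recurring `StaysOnNewest`.
* §17 THE TRANSPORTED LINEAGE (W3) [new]: `lineage` (`h_0 = D^{((s−1)e_{f_0})} G_0`, `h_{n+1} = translate b_n (cT₁^{j_n} h_n)`)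
  and `lineage_facts`: `h_n ∈ hasseSpan (s−1) G_n`, `h_n(0) = 0`, `coeff_{y_{f_n}} h_n ≠ 0`, linear part `μ_n ℓ_n` (uses
  `(s : K) ≠ 0`, i.e. TAMENESS `p ∤ s` — probe (w4)).
* §18 ONE-STEP JET TRANSPORT, PACKAGED (W4/W5/W7) [new]: `jet_transport` (lost-wall move: `ζ' = cT₁ʲζ − b_z` is again a
  `z`-free jet of depth `≥ D − 1`, `b_z = coeff_{y_j} ζ`, unit cofactor kept) and `jet_rotation` (free-chart move: the factor
  form rotates, the germ `g = translate b (1 − cT₁ᶻ ζ)` has `coeff_{y_m} g = −coeff_{y_m} ζ`, and EVERY jet `ζ₂` of `g` of depth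
  `D₂` is a jet of `h'` of depth `min (D₂+1) D − 1`).
* §19 THE TERMINAL CONTRADICTION (K3 at walk level) [new]: `no_isolation_of_presentation` — a presentation of `σ_ζ G` all of
  whose indices satisfy `s ≤ n_v + n_z` (wall `v`, free `z`), far part `(M+1+q)`-deep, inside `F = y^r U G + C_q` with
  `q ≤ r_v + s` and `C_q` Hasse-flat below `q`, forbids `g·y_u^M ∈ topIdeal q F` for `g(0) ≠ 0`.
* §20 THE TORIC SHADOW (letters/slots/word) [new]: `toric_slots` — slot functions `S1, S2` (the two walls, `r = q − s`), the
  free letter `f`, the word `w` (`w τ = true` iff slot 1 is lost), kept/lost data per move, and the SWITCH LAW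
  `StaysOnNewest (N+τ) → w (τ+1) ≠ w τ`.
* §21 PRESENTATION STEPS, PACKAGED [new]: far toolkit (`far_mono/add/sum/of_varFree/of_mem_span/monomial_mul`),
  `presentation_transport_step` (lost wall: labels by `chartExponent`, units by `cT₀ʲ`, far by `cT_sʲ`, threshold `−s`) and
  `presentation_freeChart_step` (free chart: labels `n ↦ (n_u, |n|−s, n_z)` in letters `(kept, new wall, new free)`, units
  `Ψ(U)(y_v+β+ζ₂)^{n_v} Q̃^{n_z}`, remainder far for threshold `Λ − s`), `constantCoeff_zshear`, and COEFFICIENT STABILITY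
  `coeff_zshear_stable` (a deeper jet changes no near coefficient).
* §22 THE CHAIN THEOREM [new]: `presentation_chain` / `presentation_chain_at` — for every budget `Λ₀` and all `τ` with
  `s τ ≤ Λ₀`: jet of depth `≥ Λ₀ − sτ + 1`, injective labels, units, far remainder of threshold `Λ₀ − sτ`, and the TORIC LINK:
  `(ι_τ a)(f_τ) = a(f_0)` and the wall exponents shifted by `s − a(f_0)` ARE `ExtinctionCut.orbit w x₀(a) τ`.
* §23 THE PORT [new]: `balancedWallPort_holds` — layer law (`NearCut.layer_of_structure`, body of `NearCut.companionLaw`, no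
  hypothesis on `e`) + `NearCut.directrix_of_plateau` give `in_s G_n = c_n ℓ_n^s`; §16, §17, §20;
  `ExtinctionCut.both_letters_of_switches`; horizon `T = max t_U t_V + s + 1`, isolation exponent `M` at `N + T`, budget
  `Λ₀ = sT + (M+1+q)`; K2 AT ALL TIMES for the near indices of budget `Λ₀` by the chains of every larger budget +
  `jet_unique` + `coeff_zshear_stable`; `ExtinctionCut.extinction`; the chain at `T`; §19 against `W.isolated (N+T)`.
* §24 CONSEQUENCES [wiring only]: `kollarWallPort_holds`, `noTameBalancedStrictTailsDeep_holds`,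
  `noBalancedBoundaryTailsDeep_holds`, `defectWalksDeep_iff_lossy_wild`.

PIECES / TAGS: §§1–11, 13, 15–23 NEW kernel theorems [new] (162 theorems + 6 definitions, none Prop-valued: the algebra maps
`zshear`, `vsubst`, `total`, `rotSubst`, the ideal `hasseSpan`, the polynomial sequence `lineage`; "`ζ` is `z`-free" is
spelled out as `∀ μ ∈ ζ.support, μ z = 0`; no theorem binds a Prop-valued port or a named fact); §5 uses Literature Giraud
[KNOWN, by name]; §12 [new, exhibit, RUN]; §24 [wiring]; §14 [COSTUME rider, item 33395].  Imports: landed Theorems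
(`NearCutCompanion3`, `NearCutWalls2`, `ProximityCutArcLaw`, `MaxContactCutBoundaryLedger`, `MaxContactCutWallCut`,
`PlanarGhostDescent`) + Literature (`PointBlowupIFPGiraud`, `AdicNoetherian`) + HarnessLib only (w1).
WHY NOVEL: Kollár's 2.59 transport is proved in print over `K[[u,v]]` after Weierstrass preparation and only for the two
torus charts of HIS coordinates; the walk's charts are the AMBIENT ones, where free-chart near moves exist (§12) and break
monomiality.  The polynomial frame (shear + factor-theorem jets + one transported Hasse lineage + labelled unit-weighted
presentations + rotation law + per-budget chains glued by coefficient stability) restores EXACT set dynamics of the support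
indices in every chart the walk may take, in every characteristic, inside `MvPolynomial` — no completion, no division — and
serves the for-all-times potential hypothesis of the landed toric extinction theorem without any uniform frame.
HONEST PLACEMENT: the mathematics is Kollár's resolution-of-surfaces coefficient-curve argument [Kollar2007 §2.7] combined with
the CJS near-point calculus [CossartJannsenSaito2020 §5] and Giraud's Hasse-derivative persistence; new here is the
division-free polynomial-frame execution in kernel and the resulting hypothesis-free closure of the tame balanced cells of
the deep tight-defect column; the column's residual is now EXACTLY `NoLossyStrictTailsDeep ∧ NoWildBalancedStrictTailsDeep`
(`defectWalksDeep_iff_lossy_wild`), the wild (`p ∣ s`) balanced cell being a separate +1 (row 219a (P4)).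
-/

open MvPolynomial Finset
open scoped BigOperators
open Literature.AlgebraicGeometry.Resolution
open Literature.AlgebraicGeometry.Resolution.Hauser2010
open Literature.AlgebraicGeometry.Resolution.PointBlowup
open Literature.AlgebraicGeometry.Resolution.HauserPerlega2024

namespace Summit.ResolutionOfSingularities.ResolutionOfSingularities.Theorems.WallFrames

variable {σ : Type*} [Fintype σ] [DecidableEq σ] {K : Type*} [Field K]

/-! ## §1 The shear automorphism `y_z ↦ y_z + ζ` -/

/-! Throughout, "`ζ` is `z`-free" is the support condition `∀ μ ∈ ζ.support, μ z = 0` (written out; no predicate is defined). -/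

/-- The shear substitution `y_z ↦ y_z + ζ`, all other variables fixed. DEFINITION (support). -/
noncomputable def zshear (z : σ) (ζ : MvPolynomial σ K) : MvPolynomial σ K →ₐ[K] MvPolynomial σ K :=
  aeval (fun i => if i = z then X z + ζ else X i)

omit [Fintype σ] in
/-- `zshear_X_self`: WallFrames (lens-5 g35) computation rule; docstring added by the writer (lint.docstring) [folklore] -/
theorem zshear_X_self (z : σ) (ζ : MvPolynomial σ K) : zshear z ζ (X z) = X z + ζ := by
  unfold zshear; rw [aeval_X, if_pos rfl]

omit [Fintype σ] in
/-- `zshear_X_of_ne`: WallFrames (lens-5 g35) computation rule; docstring added by the writer (lint.docstring) [folklore] -/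
theorem zshear_X_of_ne {z i : σ} (h : i ≠ z) (ζ : MvPolynomial σ K) : zshear z ζ (X i) = X i := by
  unfold zshear; rw [aeval_X, if_neg h]

omit [Fintype σ] in
/-- `zshear_C`: WallFrames (lens-5 g35) computation rule; docstring added by the writer (lint.docstring) [folklore] -/
theorem zshear_C (z : σ) (ζ : MvPolynomial σ K) (c : K) : zshear z ζ (C c) = C c := by
  unfold zshear; rw [aeval_C, algebraMap_eq]

omit [Fintype σ] [DecidableEq σ] in
/-- A `z`-free polynomial is supported away from `z`. [folklore] -/
theorem mem_supported_of_varFree {z : σ} {ζ : MvPolynomial σ K} (h : (∀ μ ∈ ζ.support, μ z = 0)) :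
    ζ ∈ MvPolynomial.supported K ({i | i ≠ z} : Set σ) := by
  rw [MvPolynomial.mem_supported]
  intro i hi
  simp only [Set.mem_setOf_eq]
  rintro rfl
  rw [Finset.mem_coe, MvPolynomial.mem_vars_iff_mem_support] at hi
  obtain ⟨d, hd, hid⟩ := hi
  exact (Finsupp.mem_support_iff.mp hid) (h d hd)

omit [Fintype σ] in
/-- The shear fixes every `z`-free polynomial. [folklore] -/
theorem zshear_of_varFree {z : σ} (ζ : MvPolynomial σ K) {P : MvPolynomial σ K} (hP : (∀ μ ∈ P.support, μ z = 0)) :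
    zshear z ζ P = P := by
  have hmem := mem_supported_of_varFree hP
  rw [supported_eq_range_rename, AlgHom.mem_range] at hmem
  obtain ⟨Q, rfl⟩ := hmem
  unfold zshear
  rw [aeval_rename]
  have hf : (((fun i => if i = z then X z + ζ else X i) ∘ (Subtype.val : {i : σ | i ≠ z} → σ)) :
      {i : σ | i ≠ z} → MvPolynomial σ K) = X ∘ Subtype.val := by
    funext i
    simp only [Function.comp_apply]
    rw [if_neg i.2]
  rw [hf, ← aeval_rename, aeval_X_left]
  rfl

omit [Fintype σ] in
/-- Composition of shears with `z`-free data: `σ_ζ ∘ σ_η = σ_{ζ+η}`. [folklore] -/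
theorem zshear_zshear {z : σ} {ζ η : MvPolynomial σ K} (hη : (∀ μ ∈ η.support, μ z = 0)) (P : MvPolynomial σ K) :
    zshear z ζ (zshear z η P) = zshear z (η + ζ) P := by
  have hfix := zshear_of_varFree ζ hη
  unfold zshear at hfix ⊢
  rw [← AlgHom.comp_apply, comp_aeval]
  have hfun : (fun i => aeval (fun i => if i = z then X z + ζ else (X i : MvPolynomial σ K))
      (if i = z then X z + η else (X i : MvPolynomial σ K))) =
      fun i => if i = z then X z + (η + ζ) else (X i : MvPolynomial σ K) := by
    funext i
    by_cases hi : i = z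
    · subst hi
      rw [if_pos rfl, if_pos rfl, map_add, aeval_X, if_pos rfl, hfix]; ring
    · rw [if_neg hi, if_neg hi, aeval_X, if_neg hi]
  rw [hfun]

omit [Fintype σ] in
/-- The shear by `−ζ` inverts the shear by `ζ` (`ζ` `z`-free). [folklore] -/
theorem zshear_neg_zshear {z : σ} {ζ : MvPolynomial σ K} (hζ : (∀ μ ∈ ζ.support, μ z = 0)) (P : MvPolynomial σ K) :
    zshear z (-ζ) (zshear z ζ P) = P := by
  rw [zshear_zshear hζ, add_neg_cancel]
  unfold zshear
  have : (fun i => if i = z then X z + (0 : MvPolynomial σ K) else X i) = X := by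
    funext i; split_ifs with h <;> simp [h]
  rw [this, aeval_X_left, AlgHom.id_apply]

omit [Fintype σ] [DecidableEq σ] in
/-- `varFree_neg`: WallFrames (lens-5 g35) computation rule; docstring added by the writer (lint.docstring) [folklore] -/
theorem varFree_neg {z : σ} {ζ : MvPolynomial σ K} (h : (∀ μ ∈ ζ.support, μ z = 0)) : (∀ μ ∈ (-ζ).support, μ z = 0) := by
  intro d hd; rw [support_neg] at hd; exact h d hd

omit [Fintype σ] in
/-- `zshear_zshear_neg`: WallFrames (lens-5 g35) computation rule; docstring added by the writer (lint.docstring) [folklore] -/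
theorem zshear_zshear_neg {z : σ} {ζ : MvPolynomial σ K} (hζ : (∀ μ ∈ ζ.support, μ z = 0)) (P : MvPolynomial σ K) :
    zshear z ζ (zshear z (-ζ) P) = P := by
  have := zshear_neg_zshear (varFree_neg hζ) P
  rwa [neg_neg] at this

omit [Fintype σ] in
/-- **JET CONSISTENCY.**  Deepening the shear by `ε` changes a polynomial only by a multiple of `ε`:
`zshear z ε Q − Q ∈ (ε)`.  (With `ε` supported in wall-degree `≥ Λ`, presentations built from two jets of the same
frame agree below wall-degree `Λ`.) [folklore] -/
theorem zshear_sub_self_mem_span (z : σ) (ε Q : MvPolynomial σ K) : zshear z ε Q - Q ∈ Ideal.span {ε} := by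
  induction Q using MvPolynomial.induction_on with
  | C c => rw [zshear_C, sub_self]; exact Ideal.zero_mem _
  | add p q hp hq =>
    rw [map_add, show zshear z ε p + zshear z ε q - (p + q) = (zshear z ε p - p) + (zshear z ε q - q) by ring]
    exact Ideal.add_mem _ hp hq
  | mul_X p i hp =>
    rw [map_mul]
    by_cases hi : i = z
    · subst hi
      rw [zshear_X_self, show zshear i ε p * (X i + ε) - p * X i = (zshear i ε p - p) * X i + zshear i ε p * ε by ring]
      exact Ideal.add_mem _ (Ideal.mul_mem_right _ _ hp) (Ideal.mul_mem_left _ _ (Ideal.subset_span rfl))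
    · rw [zshear_X_of_ne hi, show zshear z ε p * X i - p * X i = (zshear z ε p - p) * X i by ring]
      exact Ideal.mul_mem_right _ _ hp

omit [Fintype σ] in
/-- **UNSHEARING IDEALS.**  If the sheared polynomial lies in `(span S)^n` then the polynomial itself lies in
`(span (unshear '' S))^n`; used with `S = {y_v, y_z}` (frame power `(y_v, y_z − ζ)^s`) and `S = {y_u, y_v}` (far part).
[folklore] -/
theorem mem_span_pow_of_zshear_mem {z : σ} {ζ : MvPolynomial σ K} (hζ : (∀ μ ∈ ζ.support, μ z = 0))
    {S : Set (MvPolynomial σ K)} {n : ℕ} {G : MvPolynomial σ K} (h : zshear z ζ G ∈ Ideal.span S ^ n) :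
    G ∈ Ideal.span ((zshear z (-ζ)) '' S) ^ n := by
  have hG : G = zshear z (-ζ) (zshear z ζ G) := (zshear_neg_zshear hζ G).symm
  rw [hG, ← Ideal.map_span, ← Ideal.map_pow]
  exact Ideal.mem_map_of_mem _ h

omit [Fintype σ] in
/-- The shear is injective (it has a two-sided inverse). [folklore] -/
theorem zshear_injective {z : σ} {ζ : MvPolynomial σ K} (hζ : (∀ μ ∈ ζ.support, μ z = 0)) : Function.Injective (zshear z ζ) :=
  fun P Q h => by simpa [zshear_neg_zshear hζ] using congrArg (zshear z (-ζ)) h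

omit [Fintype σ] in
/-- The shear by an `𝔪`-element does not lower the order at the origin. [folklore] -/
theorem le_ordZero_zshear {z : σ} {ζ : MvPolynomial σ K} (hζ1 : (1 : ℕ∞) ≤ ordZero ζ) (P : MvPolynomial σ K) :
    ordZero P ≤ ordZero (zshear z ζ P) := by
  by_cases hP : P = 0
  · subst hP; simp [zshear]
  obtain ⟨n, hn⟩ := exists_ordZero_eq_natCast hP
  rw [hn, natCast_le_ordZero_iff_mem_idealOfVars_pow]
  have hPmem : P ∈ idealOfVars σ K ^ n := (natCast_le_ordZero_iff_mem_idealOfVars_pow P n).mp hn.symm.le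
  unfold zshear
  have hmap : Ideal.map (aeval fun i => if i = z then X z + ζ else (X i : MvPolynomial σ K)).toRingHom
      (idealOfVars σ K) ≤ idealOfVars σ K := by
    rw [idealOfVars, Ideal.map_span, Ideal.span_le]
    rintro x ⟨y, ⟨i, rfl⟩, rfl⟩
    simp only [AlgHom.toRingHom_eq_coe, RingHom.coe_coe, aeval_X, SetLike.mem_coe]
    split_ifs with h
    · refine Ideal.add_mem _ (Ideal.subset_span ⟨z, rfl⟩) ?_
      exact (one_le_ordZero_iff_mem_idealOfVars ζ).mp hζ1
    · exact Ideal.subset_span ⟨i, rfl⟩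
  have := Ideal.mem_map_of_mem (aeval fun i => if i = z then X z + ζ else (X i : MvPolynomial σ K)).toRingHom hPmem
  rw [Ideal.map_pow] at this
  exact Ideal.pow_right_mono hmap n this

omit [Fintype σ] in
/-- The shear by an `𝔪`-element preserves the order at the origin exactly. [folklore] -/
theorem ordZero_zshear {z : σ} {ζ : MvPolynomial σ K} (hζ : (∀ μ ∈ ζ.support, μ z = 0)) (hζ1 : (1 : ℕ∞) ≤ ordZero ζ)
    (P : MvPolynomial σ K) : ordZero (zshear z ζ P) = ordZero P := by
  refine le_antisymm ?_ (le_ordZero_zshear hζ1 P)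
  have h := le_ordZero_zshear (z := z) (ζ := -ζ) (by rwa [ordZero_neg]) (zshear z ζ P)
  rwa [zshear_neg_zshear hζ P] at h

omit [Fintype σ] in
/-- Substituting `𝔪`-elements for the variables does not lower the order at the origin. [folklore] -/
theorem le_ordZero_aeval_of_forall {f : σ → MvPolynomial σ K} (hf : ∀ i, (1 : ℕ∞) ≤ ordZero (f i))
    (P : MvPolynomial σ K) : ordZero P ≤ ordZero (aeval f P) := by
  by_cases hP : P = 0
  · subst hP; simp
  obtain ⟨n, hn⟩ := exists_ordZero_eq_natCast hP
  rw [hn, natCast_le_ordZero_iff_mem_idealOfVars_pow]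
  have hPmem : P ∈ idealOfVars σ K ^ n := (natCast_le_ordZero_iff_mem_idealOfVars_pow P n).mp hn.symm.le
  have hmap : Ideal.map (aeval f).toRingHom (idealOfVars σ K) ≤ idealOfVars σ K := by
    rw [idealOfVars, Ideal.map_span, Ideal.span_le]
    rintro x ⟨y, ⟨i, rfl⟩, rfl⟩
    simp only [AlgHom.toRingHom_eq_coe, RingHom.coe_coe, aeval_X, SetLike.mem_coe]
    exact (one_le_ordZero_iff_mem_idealOfVars (f i)).mp (hf i)
  have := Ideal.mem_map_of_mem (aeval f).toRingHom hPmem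
  rw [Ideal.map_pow] at this
  exact Ideal.pow_right_mono hmap n this

end Summit.ResolutionOfSingularities.ResolutionOfSingularities.Theorems.WallFrames
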